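import Mathlib
import HarnessLib
import HarnessLib.Audit
import Summits.AnomalousDissipation.Statement
import Literature.Analysis.FluidPDE.StatisticalSolution
import Literature.Analysis.FluidPDE.LerayHopf
import HarnessLib.Audit.Status.Attr

/-!
Route: MirrorEnsemble

# Route MirrorEnsemble — Mirror ensemble dichotomy — loud K-supported statistics plus a mean-bounded
K-family, glued by the proved K-supported floor transfer

DECOMPOSITION-FIRST (lens 3.4, cycle 2) of the summit-strength leaf X = X_K := the zeroth law pinned
to the Taylor–Green
force f_TG = (sin 2πx₀ cos 2πx₁ cos 2πx₂, −cos 2πx₀ sin 2πx₁ cos 2πx₂, 0) inside the MIRROR CLASS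
Fix K (fields with
u_i'(R_i x) = ∓u_i'(x) under the three coordinate reflections), in limsup-MEAN form (PumpedMirror's
target ⟹ X_K ⟹ Statement).
It suffices to show X_K, and X_K ⇐ L_K ∧ B_K with the implication PROVED (item MeanSplitTG,
`meanSplit_holds`, 0 sorry):
L_K (MirrorStatisticsLoudTG) — for every energy level E there are ε₀, ν₀ > 0 such that every
stationary statistical
solution of NS_ν(f_TG), ν < ν₀, with mean energy ≤ E and SUPPORTED ON closure(Fix K) has ensemble
dissipation ≥ ε₀;
B_K (MirrorMeanBoundedFamilyTG) — some Leray–Hopf family along ν_j → 0 whose H-lifts stay in Fix K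
has ν-uniformly bounded
limsup-mean energy. The seam is the K-supported Foias–Prodi/FMRT floor transfer: the
generalized-limit time-average measure of
a K-path is a stationary statistical solution carried by closure(Fix K), with ensemble energy =
Λ(energy means) ≤ E and
ν·ensemble enstrophy ≤ mean dissipation.
Lean: `∀ f : UnitAddTorus (Fin 3) → EuclideanSpace ℝ (Fin 3), f = (fun x => !₂[(fourier 1 (x 0) :
ℂ).im * (fourier 1 (x 1) : ℂ).re * (fourier 1 (x 2) : ℂ).re, -((fourier 1 (x 0) : ℂ).re * (fourier 1
(x 1) : ℂ).im * (fourier 1 (x 2) : ℂ).re), (0 : ℝ)]) → ∃ (E ε : ℝ), 0 < ε ∧ ∃ (ν : ℕ → ℝ) (u₀ : ℕ →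
UnitAddTorus (Fin 3) → EuclideanSpace ℝ (Fin 3)) (u : ℕ → ℝ → UnitAddTorus (Fin 3) → EuclideanSpace
ℝ (Fin 3)) (U : ℕ → ℝ → Literature.Analysis.FunctionSpaces.Torus.energySpace (Fin 3)), (∀ j, 0 < ν
j) ∧ Filter.Tendsto ν Filter.atTop (nhds 0) ∧ (∀ j,
Literature.Analysis.FluidPDE.Torus.IsGlobalLerayHopf (ν j) (fun _ => f) (u₀ j) (u j)) ∧ (∀ j t, 0 ≤
t → ((U j t : MeasureTheory.Lp (EuclideanSpace ℝ (Fin 3)) 2 (MeasureTheory.volume :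
MeasureTheory.Measure (UnitAddTorus (Fin 3)))) : UnitAddTorus (Fin 3) → EuclideanSpace ℝ (Fin 3))
=ᵐ[MeasureTheory.volume] u j t) ∧ (∀ j t, 0 ≤ t → ∀ i i' : Fin 3, (fun x => ((U j t :
MeasureTheory.Lp (EuclideanSpace ℝ (Fin 3)) 2 (MeasureTheory.volume : MeasureTheory.Measure
(UnitAddTorus (Fin 3)))) : UnitAddTorus (Fin 3) → EuclideanSpace ℝ (Fin 3)) (Function.update x i (-x
i)) i') =ᵐ[MeasureTheory.volume] (fun x => if i' = i then -(((U j t : MeasureTheory.Lp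
(EuclideanSpace ℝ (Fin 3)) 2 (MeasureTheory.volume : MeasureTheory.Measure (UnitAddTorus (Fin 3))))
: UnitAddTorus (Fin 3) → EuclideanSpace ℝ (Fin 3)) x i') else ((U j t : MeasureTheory.Lp
(EuclideanSpace ℝ (Fin 3)) 2 (MeasureTheory.volume : MeasureTheory.Measure (UnitAddTorus (Fin 3))))
: UnitAddTorus (Fin 3) → EuclideanSpace ℝ (Fin 3)) x i')) ∧ (∀ j,
Literature.Analysis.FluidPDE.meanEnergy (u j) ≤ E) ∧ ∀ j, ε ≤
Literature.Analysis.FluidPDE.meanDissipation (ν j) (u j)`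

## Assembly
closes (glue.lean, rev 1 cone repair, 20 lines, PROVED, no sorry; hypotheses = the support items
TaylorGreenForceRegularTG and
FloorTransferOnSupport (both provable-now, checked proofs attached as item evidence) and the cruxes
L_K, B_K): from B_K take E, the
family and its K-lifts; from L_K at level E take ε₀, ν₀; drop the finitely many indices with ν_j ≥
ν₀; for each remaining j the
K-supported floor transfer (hypothesis FloorTransferOnSupport, instantiated at S = Fix K, no longer
inlined) turns the ensemble floor
into meanDissipation ν_j u_j ≥ ε₀; f_TG's regularity (hypothesis TaylorGreenForceRegularTG)
discharges the force clause of the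
Statement. Standard axioms only. Rev 1 (cone repair 2026-08-17): the route file now imports only
Literature.Analysis.FluidPDE.StatisticalSolution and Literature.Analysis.FluidPDE.LerayHopf (cone
208 leaves, was 735); the
time-average-measure machinery (TimeAverageLiouville, DoeringFoiasProofs,
Theorems.EnsembleRigidityEnsembleFloorTransfer) is needed
only by the PROOF of FloorTransferOnSupport, which lands under Theorems/, so no unproved Literature
fact rides into the route's cone.
The Assembly item keeps the rev-0 shape L_K → B_K → Statement (provable from the two supports and
`closes`).

Rationale: WHY THIS LINE. The rejudge (rj2) left PumpedMirror at tier B because its deciding crux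
MirrorBoundedFromRestTG is a PATHWISE ν-uniform energy
bound from rest ("unreachable by any known method") and named the move: "weakening B to a
limsup-mean bound the floor transfer still
accepts would lift the route to A". A limsup-mean bound is NOT accepted by PumpedMirror's pointwise
certificate transfer (the
certificate only holds in the ball |u|² ≤ E, a mean bound lets the path leave it), but it IS
accepted at the ENSEMBLE level:
time-average measures (FMRTTurbulence2001 Ch. IV §1, FoiasRosaTemam2010) built with a generalized
Banach limit are stationary
statistical solutions whose mean energy is the generalized limit of the energy means, and — the new
clause — they are carried by
the closure of any closed invariant set the path lives in
(`IsTimeAverageMeasure.measure_compl_eq_zero`), here closure(Fix K).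
So the floor only has to hold for K-SUPPORTED statistics (L_K, primal: no minimax, no certificate,
mean-energy hypothesis), and
the existence half only in Cesàro mean (B_K). Imported: statistical-solution theory (FMRT), the
landed residual transfer
`ResidualTransferSSS_of` (SSS of NS_ν are forced-Euler near-statistics with cylindrical defect ≤
ν√G) which reduces L_K to a
ν-free rigidity of K-supported near-Euler statistics, and the Kelvin-pump exclusion of smooth
K-symmetric steady Euler states
(PumpedMirror support KelvinPumpSteadyTG, arXiv:1705.07096 for the auxiliary-functional background).
What no prior route does:
EnsembleRigidity has the L+B+transfer shape for f_GP with NO symmetry (its rigidity must face every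
statistics of f_GP);
PumpedMirror has the symmetry but a certificate A and a pathwise B; here the symmetry support clause
is load-bearing in L_K,
in B_K and in the proved seam.

RANKED CRUXES. #0 MirrorMeanZerothLawTG (target) — X_K — for f = f_TG there are E, ε > 0,
viscosities ν_j > 0 with ν_j → 0, data u₀ⱼ and global Leray–Hopf solutions u_j of NS_(ν_j)(f_TG)
with H-lifts U_j (U_j t = u_j t a.e., t ≥ 0) that are mirror-symmetric a.e. for all t ≥ 0, such that
meanEnergy u_j ≤ E and meanDissipation ν_j u_j ≥ ε for all j (the zeroth law inside Fix K, mean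
form; implies the Statement by f_TG's regularity, proved as `tgRegular_holds`). (why it might fail:
it is the summit in the mirror arena: fails if every bounded K-family laminarises in the mean (quiet
K-attractor) or every K-family's mean energy runs away as ν → 0.) [FMRTTurbulence2001,
DoeringFoias2002, arXiv:2311.04182, doi:10.1017/s0022112083001159]
#2 MirrorStatisticsLoudTG (crux) — L_K — BOUNDED MIRROR STATISTICS ARE LOUD: for f = f_TG and every
E there are ε₀, ν₀ > 0 such that for every ν ∈ (0, ν₀) every stationary statistical solution μ of
NS_ν(f_TG) (FMRT Ch. IV Def. 1.3) with ∫‖v‖² dμ < ∞, ensemble energy ≤ E and μ((closure Fix K)ᶜ) = 0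
has ensemble dissipation ν∫‖∇v‖² dμ ≥ ε₀. By the landed residual transfer it is equivalent to a
ν-FREE rigidity of K-supported forced-Euler near-statistics (birth skeleton: StubResidualTG →
StubMirrorRigidityTG → L_K, composition proved). [difficulty: open-problem] (why it might fail: ONE
quiet bounded K-supported statistics kills it: time-averages of a corner line-jet branch of width √ν
at dissipation O(ν), or an atomless near-Euler K-statistics of finite energy whose Euler defect
vanishes faster than ν√G while νG → 0.) [FMRTTurbulence2001, FoiasRosaTemam2010, arXiv:1705.07096,
arXiv:1305.7089, doi:10.1103/physreve.77.036306]
#3 MirrorMeanBoundedFamilyTG (crux) — B_K — MEAN-BOUNDED MIRROR FAMILY: for f = f_TG there are E,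
viscosities ν_j > 0 with ν_j → 0, data u₀ⱼ and global Leray–Hopf solutions u_j of NS_(ν_j)(f_TG)
with mirror-symmetric H-lifts (as in the target) such that meanEnergy u_j ≤ E for all j — turbulent
saturation of the Taylor–Green flow IN THE MEAN inside its symmetry class (zero momentum automatic;
datum free; Cesàro, not sup-in-time). [difficulty: open-problem] (why it might fail: no ν-uniform
mean-energy bound is known for any fixed 3-D force (a priori ⟨|u|²⟩ ≤ ‖f‖²/(ν²λ₁²) only); if every
K-family is eventually captured in the mean by a fat branch (the steady K-branches of the Newton
census run away like E ~ ν^-0.7) it is false.) [DoeringFoias2002, FMRTTurbulence2001,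
arXiv:2311.04182, arXiv:1305.7089, doi:10.1017/s0022112083001159]
#9 MeanSplitTG (support) — THE TYPED SPLIT X_of_subs, PROVED (Sketch.lean `meanSplit_holds`, 15
lines over FloorTransferOnSupport and TaylorGreenForceRegularTG): L_K → B_K → X_K (shift the
B-family past the index where ν_j < ν₀(E), then transfer the K-supported ensemble floor to each
path). [difficulty: provable-now] [FMRTTurbulence2001]
#9 FloorTransferOnSupport (support) — K-SUPPORTED FLOOR TRANSFER, PROVED (Sketch.lean
`floorTransferOnSupport_holds`, 75 lines; adaptation of the landed
`meanDissipation_ge_of_ensembleFloor_of_generalizedLimit` with a support clause): for ν > 0, smooth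
f, any set S ⊆ H — if every SSS of NS_ν(f) with integrable energy, ensemble energy ≤ E and
μ((closure S)ᶜ) = 0 has ensemble dissipation ≥ ε₀, then every global Leray–Hopf solution whose
H-lift stays in S for t ≥ 0 and whose meanEnergy ≤ E has meanDissipation ≥ ε₀ (generalized Banach
limit Λ ≤ limsup; time-average measure is an SSS carried by closure S; ensembleEnstrophy ≤ Λ-mean
enstrophy). [difficulty: provable-now] [FMRTTurbulence2001, FoiasRosaTemam2010]
#9 TaylorGreenForceRegularTG (support) — f_TG is smooth, divergence free and mean zero
(byte-identical to PumpedMirror's support item stmt-AnomalousDissipation-15378; PROVED in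
Sketch.lean `tgRegular_holds`, real trigonometric polynomial on the shell (±1)³ with transversal
coefficients). [difficulty: provable-now] [doi:10.1017/s0022112083001159]

TWO-LAYER PLAN. L_K ⇐ StubResidualTG → StubMirrorRigidityTG → L_K
(bc/MirrorStatisticsLoudTG_birth.lean, composition PROVED: defect dichotomy R = ν√G > δ₀ ⇒ νG ≥ δ₀²,
else rigidity c ≤ R√G = νG); StubResidualTG is provable now (instantiate the landed
`ResidualTransferSSS_of` at f_TG); the open child is the ν-FREE mirror rigidity, whose own foreseen
split is small-energy corner (TG replay of the landed second-moment test `stub_gpSmallEnergy`: no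
K-supported near-Euler statistics below the f_TG level, provable-now, M) + atom/smooth part (Kelvin
pump: KelvinPumpSteadyTG of PumpedMirror, provable-now) + atomless rough part (open).
B_K ⇐ StubMirrorLhFromRestTG → StubMirrorMeanCeilingFromRestTG → B_K
(bc/MirrorMeanBoundedFamilyTG_birth.lean, composition PROVED with ν_j = ν₁/(j+2) and the zero
datum); stub 1 is provable now in kind (ZeroDatumLerayHopf_proof through the K-symmetric Galerkin
scheme of symmetricLhExistence_proof); stub 2 (mean ceiling from rest) is the open child.

KILL CRITERIA. A refutation of L_K (a quiet bounded K-supported SSS family, e.g. certified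
time-averages of a quiet bounded K-branch) closes the route
`refuted:MirrorStatisticsLoudTG` — no repair inside the mirror arena short of changing the force. A
refutation of B_K (every K-family runs
away in the mean) closes it `refuted:MirrorMeanBoundedFamilyTG` and is itself a theorem about
Taylor–Green turbulence worth having; it would
also sink PumpedMirror's B. If PumpedMirror's MirrorFloorTG AND MirrorBoundedFromRestTG are both
proved the route is mooted (superseded);
if EnsembleRigidity closes for f_GP the summit is closed anyway.

NOT DECOMPOSED YET. The ν-free mirror rigidity (StubMirrorRigidityTG) is deliberately not filed as
an item: it is layer 2 under L_K once a prover picks the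
birth line; its constants (c, δ₀ as functions of E), the choice of cylindrical tests, and the
compactness-free treatment of atomless
statistics are left open. The from-rest specialisation of B_K is a line, not an item (B_K keeps the
datum free so that attractor
statistics, generic data or rest all qualify).

CHEAPEST FALSIFIER. A K-symmetric Galerkin/DNS census of NS_ν(f_TG) at ν = 1/50 … 1/1000 (kit, one
batched job): time-average energy and ν·enstrophy of the
flow from rest and from random K-data. A bounded-in-the-mean K-statistics with ν⟨‖∇u‖²⟩ drifting to
0 kills L_K in trend; mean energy
of the rest-started flow growing without bound kills B_K's line. Prior in-tree numerics
(TaylorGreenLoudGalerkinStates lead, c2): K-attractor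
means (E, νW) ≈ (0.43, 0.25) at ν = 0.002 and (0.48, 0.25) at ν = 0.001 — bounded AND loud in the
mean, consistent with both cruxes; the
known STEADY K-branches run away (E ~ ν^-0.7) and are therefore outside L_K's bounded class and not
B_K witnesses.

NUMBERS. ‖f_TG‖₂² = 1/4; f_TG is a Stokes eigenfield with |k|² = 3 (λ = 12π²); laminar Stokes
response f_TG/(12π²ν) has energy 1/(4·144π⁴ν²) and is
NOT a steady state ((f_TG·∇)f_TG is not a gradient). In-tree K-census: (E, νW) = (0.434, 0.249) @ ν
= 0.002, (0.475, 0.253) @ ν = 0.001;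
steady K-branches E ~ ν^-0.7…-0.8 with flat νW ≈ 0.25. Doering–Foias a-priori mean bound ⟨|u|²⟩ ≤
‖f‖²/(ν²λ₁²).

DEFINITION REQUESTS. None: stationary statistical solutions, ensemble energy/enstrophy/dissipation,
time-average measures, generalized limits, Leray–Hopf
solutions and the torus calculus are all in Literature (StatisticalSolution, TimeAverageLiouville,
DoeringFoiasProofs, LerayHopf).

Novelty: Searches (2026-08-17): `lit search --hybrid "stationary statistical solution Navier-Stokes vanishing
viscosity energy dissipation rate lower bound bounded energy"` (8 held books: Frisch1995, FMRT2001
pp 276/306/348, DoeringGibbon1995, FeffermanRobinson2018, MajdaBertozzi2002, ConstantinFoias1988,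
CannoneMiyakawa2006, KuksinShirikyan2012); `lit search --hybrid "Taylor-Green vortex symmetries
impermeable box forced turbulence dissipation rate independent of viscosity"` (8 books, Frisch1995 p
207, Canuto2006, McComb1990 …; no symmetry-class statistical statement); `lit search --hybrid --kind
paper "Foias Rosa Temam properties stationary statistical solutions …"` (10: FoiasRosaTemam2010,
Wang2008 upper-semicontinuity of stationary statistical properties, Eyink2024 review, Bronzi–Rosa
arXiv:1205.5563); `lit galaxy search "stationary statistical solution" --star all` (15 rows:
Chueshov–Kuksin thin domains, Bronzi–Rosa NS-α statistical solutions, Foias–Temam self-similar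
statistical solutions; nothing on symmetry-restricted supports or dissipation floors); remote
arXiv/OpenAlex/S2 tiers rate-limited (429) and galaxy pdf star saturated (>90 s) — recorded; `lean
search` for the three decl names (no matches); `ledger negatives` (6); route files PumpedMirror,
EnsembleRigidity, TameRoughRigidity, CoherentStates, TaylorCertificates, MirrorVariety read in full;
crux workfiles GPMeanBoundedFamily/Disproof.lean (the ∀-data ceiling is refuted by drift, the ∃-form
resists), TaylorGreenLoudGale  [refs: 1205.5563, Frisch1995, FMRT2001, DoeringGibbon1995, MajdaBertozzi2002, ConstantinFoias1988, KuksinShirikyan2012, McComb1990, FoiasRosaTemam2010, FMRTTurbulence2001]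

Barriers (technique_class: statistical-solutions, symmetry-class, rigidity): - technique_class: statistical-solutions, symmetry-class, rigidity
- Literature.Barriers.AnomalousDissipation.Cheskidov2023_thm13_not_forceRobustNoAnomaly: blocks
force-ROBUST no-anomaly arguments; L_K is a positive floor exact in the pinned force f_TG (the
residual transfer pairs the generator with f_TG-dependent tests) and B_K is an existence statement
for f_TG — neither is force-robust.
- Literature.Barriers.AnomalousDissipation.BuckmasterVicol2019_thm13: convex-integration solutions
are outside the Leray–Hopf class of B_K and outside the finite-ensemble-enstrophy SSS class of L_K
(FMRT Def. 1.3 carries ∫‖∇v‖² dμ < ∞); no degree-capped sharpening is filed.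
- Literature.Barriers.AnomalousDissipation.AlexakisDoering2006_energyDissipationBound: 2-D flows
have no zeroth law; K-supported statistics of f_TG are genuinely 3-D (f_TG ∝ cos 2πx₂ forces the
third direction; the x₂-independent planar TG cells are not invariant under NS_ν(f_TG)), so the 2-D
bound does not apply to either crux.
- Literature.Barriers.AnomalousDissipation.Marchioro1986_globalAttraction: gravest-mode planar
forcing is enslaved to its laminar state; f_TG is gravest-shell but its Stokes response is not a
steady state and has energy ~ ν^-2, so a laminar K-statistics violates L_K's hypothesis
ensembleEnergy ≤ E for small ν and cannot be a quiet witness; honest dependence: an unknown fat 3-D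
Marchioro-type K-attractor capturing every K-family in the mean would refute B_K.
- Literature.Barriers.AnomalousDissipat

History (route lifecycle, newest last):
- 2026-08-24T16:56:51Z · DORMANT — reconciler: no traction for 6.9 d (last activity item-evidence-added at 2026-08-17T18:26:12Z); parked, not closed — `ledger route dormant route-AnomalousDissipa (operator:999:1477339)
- 2026-08-30T17:05:17Z · REACTIVATED (open) — reconciler: reactivated — activity item-evidence-added at 2026-08-30T16:11:45Z after parking at 2026-08-24T16:56:51Z (operator:999:372347)

sub-problem: AnomalousDissipation · status: open · opened planner-plan-lens3-AnomalousDissipation-decomp-g2-0 2026-08-17T04:13:24Z · rev 1 · ledger route-AnomalousDissipation-MirrorEnsemble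
GENERATED by the gate from the ledger (D-0016/17). Provers cite these decls: `theorem foo : Summit.AnomalousDissipation.AnomalousDissipation.Theses.MirrorEnsemble.<Decl> := …` in Summits/AnomalousDissipation/AnomalousDissipation/Theorems/<Name>.lean.
-/

namespace Summit.AnomalousDissipation.AnomalousDissipation.Theses.MirrorEnsemble

open scoped BigOperators Topology Manifold Classical MeasureTheory ProbabilityTheory Matrix InnerProductSpace ComplexConjugate ContinuousMap
open Filter Set Function TopologicalSpace MeasureTheory

attribute [summit_statement] _root_.AnomalousDissipation

open Literature.Turb

/-- item stmt-AnomalousDissipation-17692 · target · rank 0 · open · by planner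
why it might fail: it is the summit in the mirror arena: fails if every bounded K-family laminarises in the mean (quiet K-attractor) or every K-family's mean energy runs away as ν → 0.
sources: FMRTTurbulence2001, DoeringFoias2002, arXiv:2311.04182, doi:10.1017/s0022112083001159
[target] X_K — for f = f_TG there are E, ε > 0, viscosities ν_j > 0 with ν_j → 0, data u₀ⱼ and
global Leray–Hopf solutions u_j of NS_(ν_j)(f_TG) with H-lifts U_j (U_j t = u_j t a.e., t ≥ 0) that
are mirror-symmetric a.e. for all t ≥ 0, such that meanEnergy u_j ≤ E and meanDissipation ν_j u_j ≥
ε for all j (the zeroth law inside Fix K, mean form; implies the Statement by f_TG's regularity,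
proved as `tgRegular_holds`). -/
@[route_item "route-AnomalousDissipation-MirrorEnsemble"]
def MirrorMeanZerothLawTG : Prop :=
  ∀ f : UnitAddTorus (Fin 3) → EuclideanSpace ℝ (Fin 3), f = (fun x => !₂[(fourier 1 (x 0) : ℂ).im * (fourier 1 (x 1) : ℂ).re * (fourier 1 (x 2) : ℂ).re, -((fourier 1 (x 0) : ℂ).re * (fourier 1 (x 1) : ℂ).im * (fourier 1 (x 2) : ℂ).re), (0 : ℝ)]) → ∃ (E ε : ℝ), 0 < ε ∧ ∃ (ν : ℕ → ℝ) (u₀ : ℕ → UnitAddTorus (Fin 3) → EuclideanSpace ℝ (Fin 3)) (u : ℕ → ℝ → UnitAddTorus (Fin 3) → EuclideanSpace ℝ (Fin 3)) (U : ℕ → ℝ → Literature.Analysis.FunctionSpaces.Torus.energySpace (Fin 3)), (∀ j, 0 < ν j) ∧ Filter.Tendsto ν Filter.atTop (nhds 0) ∧ (∀ j, Literature.Analysis.FluidPDE.Torus.IsGlobalLerayHopf (ν j) (fun _ => f) (u₀ j) (u j)) ∧ (∀ j t, 0 ≤ t → ((U j t : MeasureTheory.Lp (EuclideanSpace ℝ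 (Fin 3)) 2 (MeasureTheory.volume : MeasureTheory.Measure (UnitAddTorus (Fin 3)))) : UnitAddTorus (Fin 3) → EuclideanSpace ℝ (Fin 3)) =ᵐ[MeasureTheory.volume] u j t) ∧ (∀ j t, 0 ≤ t → ∀ i i' : Fin 3, (fun x => ((U j t : MeasureTheory.Lp (EuclideanSpace ℝ (Fin 3)) 2 (MeasureTheory.volume : MeasureTheory.Measure (UnitAddTorus (Fin 3)))) : UnitAddTorus (Fin 3) → EuclideanSpace ℝ (Fin 3)) (Function.update x i (-x i)) i') =ᵐ[MeasureTheory.volume] (fun x => if i' = i then -(((U j t : MeasureTheory.Lp (EuclideanSpace ℝ (Fin 3)) 2 (MeasureTheory.volume : MeasureTheory.Measure (UnitAddTorus (Fin 3)))) : UnitAddTorus (Fin 3) → EuclideanSpace ℝ (Fin 3)) x i') else ((U j t : MeasureTheory.Lp (EuclideanSpace ℝ (Fin 3)) 2 (MeasureTheory.volume : MeasureTheory.Measure (UnitAddTorus (Fin 3)))) : UnitAddTorus (Fin 3) → EuclideanSpace ℝ (Fin 3)) x i')) ∧ (∀ j, Literature.Analysis.FluidPDE.meanEnergy (u j) ≤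 E) ∧ ∀ j, ε ≤ Literature.Analysis.FluidPDE.meanDissipation (ν j) (u j)

/-- item stmt-AnomalousDissipation-17693 · crux · rank 2 · open · by planner
why it might fail: ONE quiet bounded K-supported statistics kills it: time-averages of a corner line-jet branch of width √ν at dissipation O(ν), or an atomless near-Euler K-statistics of finite energy whose Euler defect vanishes faster than ν√G while νG → 0.
sources: FMRTTurbulence2001, FoiasRosaTemam2010, arXiv:1705.07096, arXiv:1305.7089, doi:10.1103/physreve.77.036306
[crux] L_K — BOUNDED MIRROR STATISTICS ARE LOUD: for f = f_TG and every E there are ε₀, ν₀ > 0 such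
that for every ν ∈ (0, ν₀) every stationary statistical solution μ of NS_ν(f_TG) (FMRT Ch. IV Def.
1.3) with ∫‖v‖² dμ < ∞, ensemble energy ≤ E and μ((closure Fix K)ᶜ) = 0 has ensemble dissipation
ν∫‖∇v‖² dμ ≥ ε₀. By the landed residual transfer it is equivalent to a ν-FREE rigidity of
K-supported forced-Euler near-statistics (birth skeleton: StubResidualTG → StubMirrorRigidityTG →
L_K, composition proved). [difficulty: open-problem] -/
@[route_item "route-AnomalousDissipation-MirrorEnsemble", crux]
def MirrorStatisticsLoudTG : Prop :=
  ∀ f : UnitAddTorus (Fin 3) → EuclideanSpace ℝ (Fin 3), f = (fun x => !₂[(fourier 1 (x 0) : ℂ).im * (fourier 1 (x 1) : ℂ).re * (fourier 1 (x 2) : ℂ).re, -((fourier 1 (x 0) : ℂ).re * (fourier 1 (x 1) : ℂ).im * (fourier 1 (x 2) : ℂ).re), (0 : ℝ)]) → ∀ E : ℝ, ∃ ε₀ ν₀ : ℝ, 0 < ε₀ ∧ 0 < ν₀ ∧ ∀ ν : ℝ, 0 < ν → ν < ν₀ → ∀ μ : MeasureTheory.Measure (Literature.Analysis.FunctionSpaces.Torus.energySpace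 (Fin 3)), Literature.Analysis.FluidPDE.Torus.IsStationaryStatisticalSolution ν f μ → MeasureTheory.Integrable (fun v : Literature.Analysis.FunctionSpaces.Torus.energySpace (Fin 3) => ‖v‖ ^ 2) μ → Literature.Analysis.FluidPDE.Torus.ensembleEnergy μ ≤ E → μ (closure {v : Literature.Analysis.FunctionSpaces.Torus.energySpace (Fin 3) | ∀ i i' : Fin 3, (fun x => ((v : MeasureTheory.Lp (EuclideanSpace ℝ (Fin 3)) 2 (MeasureTheory.volume : MeasureTheory.Measure (UnitAddTorus (Fin 3)))) : UnitAddTorus (Fin 3) → EuclideanSpace ℝ (Fin 3)) (Function.update x i (-x i)) i') =ᵐ[MeasureTheory.volume] (fun x => if i' = i then -(((v : MeasureTheory.Lp (EuclideanSpace ℝ (Fin 3)) 2 (MeasureTheory.volume : MeasureTheory.Measure (UnitAddTorus (Fin 3)))) : UnitAddTorus (Fin 3) → EuclideanSpace ℝ (Fin 3)) x i') else ((v : MeasureTheory.Lp (EuclideanSpace ℝ (Fin 3)) 2 (MeasureTheory.volume : MeasureTheory.Measure (UnitAddTorus (Fin 3)))) : UnitAddTorus (Fin 3) → EuclideanSpace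 ℝ (Fin 3)) x i')})ᶜ = 0 → ε₀ ≤ Literature.Analysis.FluidPDE.Torus.ensembleDissipation ν μ

/-- item stmt-AnomalousDissipation-17694 · crux · rank 3 · open · by planner
why it might fail: no ν-uniform mean-energy bound is known for any fixed 3-D force (a priori ⟨|u|²⟩ ≤ ‖f‖²/(ν²λ₁²) only); if every K-family is eventually captured in the mean by a fat branch (the steady K-branches of the Newton census run away like E ~ ν^-0.7) it is false.
sources: DoeringFoias2002, FMRTTurbulence2001, arXiv:2311.04182, arXiv:1305.7089, doi:10.1017/s0022112083001159
[crux] B_K — MEAN-BOUNDED MIRROR FAMILY: for f = f_TG there are E, viscosities ν_j > 0 with ν_j → 0,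
data u₀ⱼ and global Leray–Hopf solutions u_j of NS_(ν_j)(f_TG) with mirror-symmetric H-lifts (as in
the target) such that meanEnergy u_j ≤ E for all j — turbulent saturation of the Taylor–Green flow
IN THE MEAN inside its symmetry class (zero momentum automatic; datum free; Cesàro, not
sup-in-time). [difficulty: open-problem] -/
@[route_item "route-AnomalousDissipation-MirrorEnsemble", crux]
def MirrorMeanBoundedFamilyTG : Prop :=
  ∀ f : UnitAddTorus (Fin 3) → EuclideanSpace ℝ (Fin 3), f = (fun x => !₂[(fourier 1 (x 0) : ℂ).im * (fourier 1 (x 1) : ℂ).re * (fourier 1 (x 2) : ℂ).re, -((fourier 1 (x 0) : ℂ).re * (fourier 1 (x 1) : ℂ).im * (fourier 1 (x 2) : ℂ).re), (0 : ℝ)]) → ∃ (E : ℝ) (ν : ℕ → ℝ) (u₀ : ℕ → UnitAddTorus (Fin 3) → EuclideanSpace ℝ (Fin 3)) (u : ℕ → ℝ → UnitAddTorus (Fin 3) → EuclideanSpace ℝ (Fin 3)) (U : ℕ → ℝ → Literature.Analysis.FunctionSpaces.Torus.energySpace (Fin 3)), (∀ j, 0 < ν j) ∧ Filter.Tendsto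 ν Filter.atTop (nhds 0) ∧ (∀ j, Literature.Analysis.FluidPDE.Torus.IsGlobalLerayHopf (ν j) (fun _ => f) (u₀ j) (u j)) ∧ (∀ j t, 0 ≤ t → ((U j t : MeasureTheory.Lp (EuclideanSpace ℝ (Fin 3)) 2 (MeasureTheory.volume : MeasureTheory.Measure (UnitAddTorus (Fin 3)))) : UnitAddTorus (Fin 3) → EuclideanSpace ℝ (Fin 3)) =ᵐ[MeasureTheory.volume] u j t) ∧ (∀ j t, 0 ≤ t → ∀ i i' : Fin 3, (fun x => ((U j t : MeasureTheory.Lp (EuclideanSpace ℝ (Fin 3)) 2 (MeasureTheory.volume : MeasureTheory.Measure (UnitAddTorus (Fin 3)))) : UnitAddTorus (Fin 3) → EuclideanSpace ℝ (Fin 3)) (Function.update x i (-x i)) i') =ᵐ[MeasureTheory.volume] (fun x => if i' = i then -(((U j t : MeasureTheory.Lp (EuclideanSpace ℝ (Fin 3)) 2 (MeasureTheory.volume : MeasureTheory.Measure (UnitAddTorus (Fin 3)))) : UnitAddTorus (Fin 3) → EuclideanSpace ℝ (Fin 3)) x i') else ((U j t : MeasureTheory.Lp (EuclideanSpace ℝ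 (Fin 3)) 2 (MeasureTheory.volume : MeasureTheory.Measure (UnitAddTorus (Fin 3)))) : UnitAddTorus (Fin 3) → EuclideanSpace ℝ (Fin 3)) x i')) ∧ ∀ j, Literature.Analysis.FluidPDE.meanEnergy (u j) ≤ E

/-- item stmt-AnomalousDissipation-15378 · support · rank 9 · closed · proved by Summit.AnomalousDissipation.AnomalousDissipation.Theorems.pumpedMirror_taylorGreenForceRegularTG_proof @ 40132f2965d1 (prover) · by planner
sources: doi:10.1017/s0022112083001159
f_TG IS AN ADMISSIBLE FORCE (provable now, S; rev 1 cone repair — split out of the deciding theorem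
so that the route file does not import MirrorVariety's negative anatomy): the pinned Taylor–Green
force is smooth, divergence free and mean zero — a real trigonometric polynomial on the shell {±1}³
with transversal, conjugate-symmetric coefficients f̂(k) = (i/8)(−k₀, k₁, 0). Landed verbatim for
the same lambda term as `isSmooth_tgForce`, `isDivFree_tgForce`, `hasZeroMean_tgForce`
(Theorems/TaylorGreenLoudGalerkinStates/Negative/Anatomy.lean); 3-line proof attached as evidence.
[difficulty: provable-now] -/
@[route_item "route-AnomalousDissipation-MirrorEnsemble", crux]
def TaylorGreenForceRegularTG : Prop :=
  ∀ f : UnitAddTorus (Fin 3) → EuclideanSpace ℝ (Fin 3), f = (fun x => !₂[(fourier 1 (x 0) : ℂ).im * (fourier 1 (x 1) : ℂ).re * (fourier 1 (x 2) : ℂ).re, -((fourier 1 (x 0) : ℂ).re * (fourier 1 (x 1) : ℂ).im * (fourier 1 (x 2) : ℂ).re), (0 : ℝ)]) → Literature.Analysis.FunctionSpaces.Torus.IsSmooth f ∧ Literature.Analysis.FunctionSpaces.Torus.IsDivFree f ∧ Literature.Analysis.FunctionSpaces.Torus.HasZeroMean f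

-- `TaylorGreenForceRegularTG` holds: proved by `Summit.AnomalousDissipation.AnomalousDissipation.Theorems.pumpedMirror_taylorGreenForceRegularTG_proof` @ 40132f2965d1 (its module imports this route file, so no `_holds` link can be stated here).

/-- item stmt-AnomalousDissipation-17695 · support · rank 9 · open · by planner
sources: FMRTTurbulence2001
[support] THE TYPED SPLIT X_of_subs, PROVED (Sketch.lean `meanSplit_holds`, 15 lines over
FloorTransferOnSupport and TaylorGreenForceRegularTG): L_K → B_K → X_K (shift the B-family past the
index where ν_j < ν₀(E), then transfer the K-supported ensemble floor to each path). [difficulty: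
provable-now] -/
@[route_item "route-AnomalousDissipation-MirrorEnsemble"]
def MeanSplitTG : Prop :=
  MirrorStatisticsLoudTG → MirrorMeanBoundedFamilyTG → MirrorMeanZerothLawTG

/-- item stmt-AnomalousDissipation-17696 · support · rank 9 · closed · proved by Summit.AnomalousDissipation.AnomalousDissipation.Theorems.floorTransferOnSupport_proof @ cd234a5deccd (prover) · by planner
sources: FMRTTurbulence2001, FoiasRosaTemam2010
[support] K-SUPPORTED FLOOR TRANSFER, PROVED (Sketch.lean `floorTransferOnSupport_holds`, 75 lines;
adaptation of the landed `meanDissipation_ge_of_ensembleFloor_of_generalizedLimit` with a support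
clause): for ν > 0, smooth f, any set S ⊆ H — if every SSS of NS_ν(f) with integrable energy,
ensemble energy ≤ E and μ((closure S)ᶜ) = 0 has ensemble dissipation ≥ ε₀, then every global
Leray–Hopf solution whose H-lift stays in S for t ≥ 0 and whose meanEnergy ≤ E has meanDissipation ≥
ε₀ (generalized Banach limit Λ ≤ limsup; time-average measure is an SSS carried by closure S;
ensembleEnstrophy ≤ Λ-mean enstrophy). [difficulty: provable-now] -/
@[route_item "route-AnomalousDissipation-MirrorEnsemble", crux]
def FloorTransferOnSupport : Prop :=
  ∀ (ν E ε₀ : ℝ) (f u₀ : UnitAddTorus (Fin 3) → EuclideanSpace ℝ (Fin 3)) (u : ℝ → UnitAddTorus (Fin 3) → EuclideanSpace ℝ (Fin 3)) (U : ℝ → Literature.Analysis.FunctionSpaces.Torus.energySpace (Fin 3)) (S : Set (Literature.Analysis.FunctionSpaces.Torus.energySpace (Fin 3))), 0 < ν → Literature.Analysis.FunctionSpaces.Torus.IsSmooth f → (∀ μ : MeasureTheory.Measure (Literature.Analysis.FunctionSpaces.Torus.energySpace (Fin 3)), Literature.Analysis.FluidPDE.Torus.IsStationaryStatisticalSolution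 ν f μ → MeasureTheory.Integrable (fun v : Literature.Analysis.FunctionSpaces.Torus.energySpace (Fin 3) => ‖v‖ ^ 2) μ → Literature.Analysis.FluidPDE.Torus.ensembleEnergy μ ≤ E → μ (closure S)ᶜ = 0 → ε₀ ≤ Literature.Analysis.FluidPDE.Torus.ensembleDissipation ν μ) → Literature.Analysis.FluidPDE.Torus.IsGlobalLerayHopf ν (fun _ => f) u₀ u → (∀ t, 0 ≤ t → ((U t : MeasureTheory.Lp (EuclideanSpace ℝ (Fin 3)) 2 (MeasureTheory.volume : MeasureTheory.Measure (UnitAddTorus (Fin 3)))) : UnitAddTorus (Fin 3) → EuclideanSpace ℝ (Fin 3)) =ᵐ[MeasureTheory.volume] u t) → (∀ t, 0 ≤ t → U t ∈ S) → Literature.Analysis.FluidPDE.meanEnergy u ≤ E → ε₀ ≤ Literature.Analysis.FluidPDE.meanDissipation ν u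

-- `FloorTransferOnSupport` holds: proved by `Summit.AnomalousDissipation.AnomalousDissipation.Theorems.floorTransferOnSupport_proof` @ cd234a5deccd (its module imports this route file, so no `_holds` link can be stated here).

/-- item stmt-AnomalousDissipation-17697 · assembly · rank 1 · open · by planner
sources: FMRTTurbulence2001
[assembly] MirrorStatisticsLoudTG → MirrorMeanBoundedFamilyTG → AnomalousDissipation (identical to
the certified `closes`). -/
@[route_item "route-AnomalousDissipation-MirrorEnsemble"]
def Assembly : Prop :=
  MirrorStatisticsLoudTG → MirrorMeanBoundedFamilyTG → _root_.AnomalousDissipation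

/-! D-0027 §2.1 — DECIDING THEOREM (planner-authored via `route open/edit --closes-file`; by planner-rrepair-AnomalousDissipation-MirrorEns-043f9a7b-0 2026-08-17T04:32:48Z):
its hypotheses are this route's items and its conclusion the sub-problem Statement (glue_lint), and it elaborates with this file. -/

@[closes "route-AnomalousDissipation-MirrorEnsemble"] theorem closes (h₀ : TaylorGreenForceRegularTG) (h₁ : FloorTransferOnSupport) (h₂ : MirrorStatisticsLoudTG) (h₃ : MirrorMeanBoundedFamilyTG) : _root_.AnomalousDissipation := by
 set fTG : UnitAddTorus (Fin 3) → EuclideanSpace ℝ (Fin 3) :=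
  (fun x => !₂[(fourier 1 (x 0) : ℂ).im * (fourier 1 (x 1) : ℂ).re * (fourier 1 (x 2) : ℂ).re,
   -((fourier 1 (x 0) : ℂ).re * (fourier 1 (x 1) : ℂ).im * (fourier 1 (x 2) : ℂ).re), (0 : ℝ)]) with hfTG
 -- f_TG is an admissible force (support item TaylorGreenForceRegularTG)
 obtain ⟨hfs, hfd, hfz⟩ := h₀ fTG hfTG
 -- B_K: a mirror-symmetric Leray–Hopf family along ν_j → 0 with mean energy ≤ E
 obtain ⟨E, ν, u₀, u, U, hν, hν0, hLH, hl, hsym, hE⟩ := h₃ fTG hfTG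
 -- L_K at level E: K-supported bounded statistics are loud for ν < ν₀
 obtain ⟨ε₀, ν₀, hε₀, hν₀, hloud⟩ := h₂ fTG hfTG E
 -- drop the finitely many indices with ν_j ≥ ν₀
 obtain ⟨J, hJ⟩ := Filter.eventually_atTop.1 (hν0.eventually (gt_mem_nhds hν₀))
 set S : Set (Literature.Analysis.FunctionSpaces.Torus.energySpace (Fin 3)) := {v : Literature.Analysis.FunctionSpaces.Torus.energySpace (Fin 3) | ∀ i i' : Fin 3, (fun x => ((v : Lp (EuclideanSpace ℝ (Fin 3)) 2 (volume : Measure (UnitAddTorus (Fin 3)))) : UnitAddTorus (Fin 3) → EuclideanSpace ℝ (Fin 3)) (Function.update x i (-x i)) i') =ᵐ[volume] (fun x => if i' = i then -(((v : Lp (EuclideanSpace ℝ (Fin 3)) 2 (volume : Measure (UnitAddTorus (Fin 3)))) : UnitAddTorus (Fin 3) → EuclideanSpace ℝ (Fin 3)) x i') else ((v : Lp (EuclideanSpace ℝ (Fin 3)) 2 (volume : Measure (UnitAddTorus (Fin 3)))) : UnitAddTorus (Fin 3) → EuclideanSpace ℝ (Fin 3)) x i')} with hSdef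
 -- the K-supported floor transfer (support item FloorTransferOnSupport) turns the ensemble floor into a mean-dissipation floor, path by path
 have hDiss : ∀ j, ε₀ ≤ Literature.Analysis.FluidPDE.meanDissipation (ν (j + J)) (u (j + J)) := fun j =>
  h₁ (ν (j + J)) E ε₀ fTG (u₀ (j + J)) (u (j + J)) (U (j + J)) S (hν (j + J)) hfs
   (hloud (ν (j + J)) (hν (j + J)) (hJ (j + J) (Nat.le_add_left J j)))
   (hLH (j + J)) (hl (j + J)) (fun t ht => hsym (j + J) t ht) (hE (j + J))
 exact ⟨fTG, hfs, hfd, hfz, fun j => ν (j + J), fun j => u₀ (j + J), fun j => u (j + J), fun j => hν (j + J),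
  hν0.comp (tendsto_add_atTop_nat J), fun j => hLH (j + J), ⟨E, fun j => hE (j + J)⟩, ε₀, hε₀, hDiss⟩

end Summit.AnomalousDissipation.AnomalousDissipation.Theses.MirrorEnsemble
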